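import Literature.AlgebraicGeometry.ShimuraVarieties.UnitaryBallQuotientSurface
import Literature.AlgebraicGeometry.ModuliOfAbelianVarieties.SiegelComplexRecordSystem
import Literature.AlgebraicGeometry.ModuliOfAbelianVarieties.SiegelModuliDatumLocalBiholomorphism
import Literature.NumberTheory.Transcendental.AnalytificationCoordinateHolomorphyTransport
import Literature.NumberTheory.Transcendental.AnalytificationMorphismsProofs
import Literature.NumberTheory.Transcendental.AnalytificationProjProofs
import Literature.AlgebraicGeometry.Motives.ClosedGraphMorphismImmersion
import Literature.AlgebraicGeometry.Resolution.SmoothStalksRegular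
import HarnessLib

/-!
# Borel's extension theorem for ball quotients into the Siegel variety — ONE PIECE, from GAGA

Topic `AlgebraicGeometry/ShimuraVarieties`; namespace `Literature.AlgebraicGeometry.ShimuraVarieties`
(grouping sub-namespace `UnitaryBallUniformisationDatum`).  THEOREMS ONLY (no definition, no named fact,
no instance).  Cell `hodgecm-mathlib`, row #61 `siegel_borel_extension` (`SiegelBorelExtension.lean`), road
«Borel ⇐ Chow + ZMT» of the census `B-provers/B-p20/CENSUS-61-borel-via-chow.B-p20g4.md`, node L3 (the
per-piece core; the assembly over the pieces of `Sc.Mc_K` is the sibling `SiegelBorelExtensionHolds`).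

## The mathematics

Let `D₂ : UnitaryBallUniformisationDatum 2 X₂` be a compact ball-quotient datum (so `X₂` is a smooth projective
surface, field `isSmoothProjective`, analytified by the compact complex surface `Δ\𝔹²` — ★
`isAnalytification_quotientSurface`, with `𝔹² → Δ\𝔹²` a surjective local biholomorphism, ★
`isLocalDiffeomorph_quotientSurfaceMk`), `Sg` a Siegel complex record system at the principal level `KN`
(`V := Sg.Mc_{KN}` smooth quasi-projective: an immersion `e : V ⟶ P̄ ⟶ ℙᵇ`), and `f₂ : X₂(ℂ) → V(ℂ)` a point map
WITH A HOLOMORPHIC SIEGEL LIFT on the ball chart of the frame `𝔣`: `f₂ (unif (T·(z,1))) = incl_q (unif_q (Z (T·(z,1))))`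
with `Z` holomorphic on the negative cone and `Z (T·(z,1)) ∈ 𝔥_g`.  Then `f₂` is the map on complex points of a
morphism `ψ : X₂ ⟶ V`.

Proof: `F := (ℙᵇ)^an⁻¹ ∘ e(ℂ) ∘ f₂ ∘ (Δ\𝔹² ≃ X₂(ℂ))` is holomorphic — on the ball it is
`(ℙᵇ)^an⁻¹ ∘ (incl_q ≫ e)(ℂ) ∘ unif_q ∘ Z ∘ T·(·,1)`, holomorphic because `unif_q` is holomorphic in algebraic
coordinates (★ `SiegelModuliDatum.differentiableOn_unif_coord`, transported along `incl_q ≫ e` by ★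
`differentiableOn_evalOrZero_map_comp`, and «holomorphy into `Y^an` is read on regular functions» ★
`IsAnalytification.mdifferentiableAt_symm_comp`), and holomorphy descends along the local biholomorphism
`𝔹² → Δ\𝔹²`.  By GAGA for maps between smooth projective varieties (★
`Transcendental.arapura2012_cor_15_4_6_holds`, Mumford AG I (4.14) = Chow + Zariski's Main Theorem) `F` is the
analytification of a morphism `g : X₂ ⟶ ℙᵇ`; its image lies in the locally closed `e(V)` (all `ℂ`-points do), so
`g` factors through `e` (★ `Motives.exists_hom_comp_eq_of_range_subset_of_isImmersion`,
`Motives.range_subset_of_isLocallyClosed_of_forall_pt_mem`).  This is Borel's theorem [Borel 1972, 3.10] in the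
compact-source case, where the punctured-disc extension is not needed (remark (i) of `SiegelBorelExtension.lean`).

## References
* [Borel1972ExtensionTheorem] A. Borel, J. Differential Geom. 6 (1972), Thm. 3.10 p. 559.
* [Mumford1981] D. Mumford, *Algebraic Geometry I: Complex Projective Varieties*, §4B (4.14), p. 67.
* [SerreGAGA1956] J.-P. Serre, GAGA, Ann. Inst. Fourier 6 (1956), §2 n°5–6, §19 Prop. 13.
* [Milne2005ShimuraVarieties] J. S. Milne, *Introduction to Shimura varieties*, Thm. 3.14 (Borel), Thm. 5.16.
-/

set_option autoImplicit false

noncomputable section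

open Function Topology CategoryTheory CategoryTheory.Limits Matrix AlgebraicGeometry Set Filter
open scoped Matrix Manifold ContDiff LinearAlgebra.Projectivization
open Literature.AlgebraicGeometry.Motives Literature.AlgebraicGeometry.Motives.AlgPoints
open Literature.Geometry.ComplexHyperbolic Literature.Geometry.ComplexHyperbolic.BallModel
open Literature.AlgebraicGeometry.ModuliOfAbelianVarieties
open Literature.AlgebraicGeometry.HodgeTheory (IsQuasiProjectiveOver)
open Literature.NumberTheory.Transcendental
open Literature.NumberTheory.Automorphic (siegelUpperHalfSpace)
open Literature.NumberTheory.ModularForms.SiegelUpperHalfSpace (siegelUpperHalfSpaceCoord coordCLE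
  isOpen_siegelUpperHalfSpaceCoord mem_siegelUpperHalfSpaceCoord_iff)
open Literature.LinearAlgebra.Matrix (symmetricSubmodule)

namespace Literature.AlgebraicGeometry.ShimuraVarieties

namespace UnitaryBallUniformisationDatum

variable {X₂ : SchemeOver ℂ} (D₂ : UnitaryBallUniformisationDatum 2 X₂) (𝔣 : D₂.SylvesterFrame)
variable {g : ℕ} {δ : Fin g → ℕ}

omit D₂ 𝔣 in
/-- On a symmetric value, SYMMETRISED Klingen coordinates `S w {i,j} = (A(w)_{ij} + A(w)_{ji})/2` are the Klingen
coordinates: the symmetric matrix with coordinates `S w` is `A w` (private plumbing; the symmetrisation lets the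
coordinate map be written without a symmetry hypothesis). [cite: Klingen1990, Ch. I §1 Def. 2 (p. 2)] -/
private theorem coe_coordCLE_symm_of_symmetrised (A : (Fin 2 → ℂ) → Matrix (Fin g) (Fin g) ℂ)
    (S : (Fin 2 → ℂ) → Sym2 (Fin g) → ℂ) (hS : ∀ w i j, S w s(i, j) = (A w i j + A w j i) / 2)
    (w : Fin 2 → ℂ) (hA : (A w).IsSymm) :
    (((coordCLE g).symm (S w) : symmetricSubmodule (Fin g) ℂ) : Matrix (Fin g) (Fin g) ℂ) = A w := by
  ext i j
  rw [Literature.NumberTheory.ModularForms.SiegelUpperHalfSpace.coe_coordCLE_symm_apply, hS, hA.apply i j]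
  ring

omit D₂ 𝔣 in
/-- Symmetrised coordinates of a map with differentiable entries are differentiable (private plumbing).
[cite: Klingen1990, Ch. I §1 Def. 2 (p. 2)] -/
private theorem differentiableAt_of_symmetrised (A : (Fin 2 → ℂ) → Matrix (Fin g) (Fin g) ℂ)
    (S : (Fin 2 → ℂ) → Sym2 (Fin g) → ℂ) (hS : ∀ w i j, S w s(i, j) = (A w i j + A w j i) / 2)
    {w : Fin 2 → ℂ} (hA : ∀ i j, DifferentiableAt ℂ (fun w => A w i j) w) : DifferentiableAt ℂ S w := by
  refine differentiableAt_pi.2 fun s => ?_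
  induction s using Sym2.ind with
  | h i j =>
    have h : (fun w => S w s(i, j)) = fun w => (A w i j + A w j i) * (2 : ℂ)⁻¹ :=
      funext fun w => by rw [hS, div_eq_mul_inv]
    rw [h]
    have h1 : DifferentiableAt ℂ (fun w => A w i j + A w j i) w := (hA i j).add (hA j i)
    exact h1.mul_const _

/-- **Borel's extension theorem on ONE compact ball-quotient piece, from GAGA.**  `D₂` a compact ball-quotient
datum on `X₂` with Sylvester frame `𝔣`, `Sg` a Siegel complex record system, `KN` a principal level, `f₂` a point
map `X₂(ℂ) → Sg.Mc_{KN}(ℂ)` which on the ball chart of `𝔣` factors as `incl_q ∘ unif_q ∘ Z ∘ T·(·,1)` with `Z`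
holomorphic on the negative cone and `𝔥_g`-valued on the chart: then `f₂` is induced by a morphism of
`ℂ`-schemes `ψ : X₂ ⟶ Sg.Mc_{KN}`.  (GAGA for maps ★ `arapura2012_cor_15_4_6_holds` towards `ℙᵇ ⊇ P̄ ⊇ V`,
holomorphy read on regular functions, descent along the local biholomorphism `𝔹² → Δ\𝔹²`, factorisation through
the immersion `V ↪ ℙᵇ`.) [cite: Borel1972ExtensionTheorem, Thm. 3.10 p. 559]
[cite: Mumford1981, §4B (4.14) p. 67] [cite: Milne2005ShimuraVarieties, Thm. 3.14 and Thm. 5.16] -/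
theorem exists_hom_of_holomorphicSiegelLift (hδ : ∀ i, 0 < δ i) (Sg : SiegelComplexRecordSystem g δ)
    (KN : SiegelLevel δ) (f₂ : ComplexPoints X₂ → ComplexPoints (Sg.Mc.obj KN)) (q : Sg.Q KN)
    (Z : (Fin 3 → ℂ) → Matrix (Fin g) (Fin g) ℂ) (hZ : ∀ i j, DifferentiableOn ℂ (fun v => Z v i j) D₂.cone)
    (hZmem : ∀ x : Ball, Z (𝔣.t *ᵥ BallModel.lift x) ∈ siegelUpperHalfSpace g)
    (hf₂ : ∀ x : Ball, f₂ (D₂.ballUnifMap 𝔣 x) =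
      AlgPoints.map (Sg.incl KN q) ((Sg.datum KN q).unif (Z (𝔣.t *ᵥ BallModel.lift x)))) :
    ∃ ψ : X₂ ⟶ Sg.Mc.obj KN, ∀ P : ComplexPoints X₂, AlgPoints.map ψ P = f₂ P := by
  classical
  -- §0 the schemes: `X₂` smooth projective (reduced, finite type), `V` smooth quasi-projective, `e : V ↪ ℙᵇ`
  have hX : IsSmoothProjective 2 X₂ := D₂.isSmoothProjective
  haveI : SmoothOfRelativeDimension 2 X₂.hom := hX.smoothOfRelativeDimension
  haveI : Smooth X₂.hom := SmoothOfRelativeDimension.smooth 2 X₂.hom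
  haveI : LocallyOfFiniteType X₂.hom := inferInstance
  haveI : IsIntegral X₂.left := IsSmoothProjective.isIntegral_holds hX
  haveI : Smooth (Sg.Mc.obj KN).hom := Sg.smooth KN
  haveI : IsReduced (Sg.Mc.obj KN).left :=
    Literature.AlgebraicGeometry.Resolution.isReduced_of_smooth (Sg.Mc.obj KN).hom
  haveI : LocallyOfFiniteType (Sg.Mc.obj KN).hom := inferInstance
  obtain ⟨Pbar, j, hPbar, hj⟩ := Sg.quasiProjective KN
  obtain ⟨b, ι, hι⟩ := hPbar
  haveI := hj
  haveI := hι
  obtain ⟨e, he⟩ : ∃ e : Sg.Mc.obj KN ⟶ projectiveSpace b ℂ, e = j ≫ ι := ⟨_, rfl⟩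
  haveI he_imm : IsImmersion e.left := by
    rw [he, Over.comp_left]
    infer_instance
  have he_inj : Function.Injective e.left.base := e.left.isEmbedding.injective
  -- §1 the target `ℙᵇ`: smooth projective, analytified by Mathlib's projectivization
  have hP : IsSmoothProjective b (projectiveSpace b ℂ) := isSmoothProjective_projectiveSpace_holds ℂ b
  haveI : SmoothOfRelativeDimension b (projectiveSpace b ℂ).hom := hP.smoothOfRelativeDimension
  haveI : IsManifold 𝓘(ℂ, Fin b → ℂ) ω (ℙ ℂ (Fin (b + 1) → ℂ)) := isManifold_projectivization_holds ℂ b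
  have hψ : IsAnalytification (Fin b → ℂ) (projectiveSpace b ℂ) b (projPoint b) := isAnalytification_projPoint b
  -- §2 the source: the compact complex surface `Δ\𝔹²` analytifies `X₂`
  have hφ : IsAnalytification (Fin 2 → ℂ) X₂ 2 (D₂.quotientSurfaceHomeomorph 𝔣) :=
    D₂.isAnalytification_quotientSurface 𝔣
  -- §3 the map between the analytifications and its expression on the ball
  obtain ⟨F, hFdef⟩ : ∃ F : D₂.quotientSurface 𝔣 → ℙ ℂ (Fin (b + 1) → ℂ),
      F = fun m => hψ.homeomorph.symm (AlgPoints.map e (f₂ (D₂.quotientSurfaceHomeomorph 𝔣 m))) := ⟨_, rfl⟩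
  obtain ⟨uS, huS⟩ : ∃ uS : (Sym2 (Fin g) → ℂ) → ComplexPoints (projectiveSpace b ℂ),
      uS = AlgPoints.map (Sg.incl KN q ≫ e) ∘ fun v : Sym2 (Fin g) → ℂ =>
        (Sg.datum KN q).unif (((coordCLE g).symm v : symmetricSubmodule (Fin g) ℂ) : Matrix (Fin g) (Fin g) ℂ) :=
    ⟨_, rfl⟩
  set ZL : (Fin 2 → ℂ) → Matrix (Fin g) (Fin g) ℂ := fun w => Z (𝔣.t *ᵥ ![w 0, w 1, 1]) with hZL
  have hZL_ball : ∀ x : Ball, ZL x.1 = Z (𝔣.t *ᵥ BallModel.lift x) := fun x => rfl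
  -- symmetrised Klingen coordinates of `ZL`
  obtain ⟨SC, hSC⟩ : ∃ S : (Fin 2 → ℂ) → Sym2 (Fin g) → ℂ, ∀ w i j, S w s(i, j) = (ZL w i j + ZL w j i) / 2 :=
    ⟨fun w s => Sym2.lift ⟨fun i j => (ZL w i j + ZL w j i) / 2, fun i j => by ring⟩ s,
      fun w i j => by simp only [Sym2.lift_mk]⟩
  have hkey : ∀ x : Ball, F (D₂.quotientSurfaceMk 𝔣 x) = (hψ.homeomorph.symm ∘ uS) (SC x.1) := by
    intro x
    have hsym : (ZL x.1).IsSymm := (hZmem x).1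
    rw [hFdef, huS]
    change hψ.homeomorph.symm (AlgPoints.map e (f₂ (D₂.ballUnifMap 𝔣 x))) =
      hψ.homeomorph.symm (AlgPoints.map (Sg.incl KN q ≫ e) ((Sg.datum KN q).unif
        (((coordCLE g).symm (SC x.1) : symmetricSubmodule (Fin g) ℂ) : Matrix (Fin g) (Fin g) ℂ)))
    rw [coe_coordCLE_symm_of_symmetrised ZL SC hSC x.1 hsym, hZL_ball, AlgPoints.map_comp_apply, hf₂ x]
  -- §4 holomorphy on the ball
  have hcontU : ContinuousOn (fun v : Sym2 (Fin g) → ℂ =>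
      (Sg.datum KN q).unif (((coordCLE g).symm v : symmetricSubmodule (Fin g) ℂ) : Matrix (Fin g) (Fin g) ℂ))
      (siegelUpperHalfSpaceCoord g) := by
    rw [continuousOn_iff_continuous_restrict]
    exact ((Sg.datum KN q).isLocalHomeomorph_restrict_unif_coord hδ KN.three_le_N).continuous
  have hcontS : ContinuousOn uS (siegelUpperHalfSpaceCoord g) := by
    rw [huS]
    exact (AlgPoints.continuous_map _).comp_continuousOn hcontU
  have hholS := differentiableOn_evalOrZero_map_comp isOpen_siegelUpperHalfSpaceCoord hcontU
    ((Sg.datum KN q).differentiableOn_unif_coord) (Sg.incl KN q ≫ e)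
  rw [← huS] at hholS
  have hball : ∀ x : Ball, MDifferentiableAt 𝓘(ℂ, Fin 2 → ℂ) 𝓘(ℂ, Fin b → ℂ)
      (F ∘ D₂.quotientSurfaceMk 𝔣) x := by
    intro x
    have hsym : (ZL x.1).IsSymm := (hZmem x).1
    have hmem : SC x.1 ∈ siegelUpperHalfSpaceCoord g := by
      rw [mem_siegelUpperHalfSpaceCoord_iff, coe_coordCLE_symm_of_symmetrised ZL SC hSC x.1 hsym, hZL_ball]
      exact hZmem x
    -- the Siegel side: `ψ⁻¹ ∘ uS` is holomorphic at the image point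
    have hS : MDifferentiableAt 𝓘(ℂ, Sym2 (Fin g) → ℂ) 𝓘(ℂ, Fin b → ℂ) (hψ.homeomorph.symm ∘ uS)
        (SC x.1) :=
      hψ.mdifferentiableAt_symm_comp isOpen_siegelUpperHalfSpaceCoord hcontS hholS hmem
    -- the ball side: `w ↦ SC w` is differentiable at `x`
    have hcone : IsOpen (D₂.cone) := isOpen_negCone _
    have hxc : 𝔣.t *ᵥ ![x.1 0, x.1 1, 1] ∈ D₂.cone := (D₂.coneLift 𝔣 x).2
    have hZLd : ∀ i j, DifferentiableAt ℂ (fun w => ZL w i j) x.1 := by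
      intro i j
      exact ((hZ i j).differentiableAt (hcone.mem_nhds hxc)).comp x.1 (D₂.differentiable_frameLift 𝔣).differentiableAt
    have hsc : MDifferentiableAt 𝓘(ℂ, Fin 2 → ℂ) 𝓘(ℂ, Sym2 (Fin g) → ℂ)
        (SC ∘ fun w : Ball => (w.1 : Fin 2 → ℂ)) x :=
      (mdifferentiableAt_iff_differentiableAt.2 (differentiableAt_of_symmetrised ZL SC hSC hZLd)).comp x
        ((BallModel.contMDiff_coe (n := ω)).mdifferentiableAt (by simp))
    have hcomp := hS.comp x hsc
    have hfun : F ∘ D₂.quotientSurfaceMk 𝔣 = (hψ.homeomorph.symm ∘ uS) ∘ (SC ∘ fun w : Ball => (w.1 : Fin 2 → ℂ)) :=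
      funext fun w => hkey w
    rw [hfun]
    exact hcomp
  -- §5 descent along the local biholomorphism `𝔹² → Δ\𝔹²`
  have hF : MDifferentiable 𝓘(ℂ, Fin 2 → ℂ) 𝓘(ℂ, Fin b → ℂ) F := by
    intro m
    obtain ⟨z, rfl⟩ := Quotient.exists_rep m
    change MDifferentiableAt _ _ F (D₂.quotientSurfaceMk 𝔣 z)
    have hloc := D₂.isLocalDiffeomorph_quotientSurfaceMk 𝔣 z
    have h1 : MDifferentiableAt 𝓘(ℂ, Fin 2 → ℂ) 𝓘(ℂ, Fin b → ℂ) (F ∘ D₂.quotientSurfaceMk 𝔣)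
        (hloc.localInverse (D₂.quotientSurfaceMk 𝔣 z)) := by
      rw [hloc.localInverse_left_inv hloc.localInverse_mem_target]
      exact hball z
    have h2 : MDifferentiableAt 𝓘(ℂ, Fin 2 → ℂ) 𝓘(ℂ, Fin b → ℂ)
        ((F ∘ D₂.quotientSurfaceMk 𝔣) ∘ hloc.localInverse) (D₂.quotientSurfaceMk 𝔣 z) :=
      h1.comp _ (hloc.localInverse_mdifferentiableAt (by simp))
    refine h2.congr_of_eventuallyEq ?_
    filter_upwards [hloc.localInverse_eventuallyEq_right] with y hy
    simp only [Function.comp_apply, id_eq] at hy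
    simp only [Function.comp_apply, hy]
  -- §6 GAGA for maps: `F` is the analytification of a morphism `g₀ : X₂ ⟶ ℙᵇ`
  obtain ⟨g₀, hg₀⟩ := arapura2012_cor_15_4_6_holds X₂ (projectiveSpace b ℂ) hX hP (Fin 2 → ℂ)
    (D₂.quotientSurface 𝔣) (D₂.quotientSurfaceHomeomorph 𝔣) hφ (Fin b → ℂ) (ℙ ℂ (Fin (b + 1) → ℂ))
    (projPoint b) hψ F hF
  -- points of `g₀`: `g₀(P) = e(f₂ P)`
  have hg₀pt : ∀ P : ComplexPoints X₂, AlgPoints.map g₀ P = AlgPoints.map e (f₂ P) := by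
    intro P
    obtain ⟨m, rfl⟩ := (D₂.quotientSurfaceHomeomorph 𝔣).surjective P
    rw [← hg₀ m, hFdef]
    simpa only [hψ.coe_homeomorph] using hψ.homeomorph.apply_symm_apply (AlgPoints.map e (f₂ _))
  -- §7 `g₀` lands in the locally closed `e(V)`, hence factors through `e`
  have hpts : ∀ P : AlgPoints X₂ ℂ, g₀.left.base P.pt ∈ Set.range e.left.base := by
    intro P
    refine ⟨(f₂ P).pt, ?_⟩
    change (AlgPoints.map e (f₂ P)).pt = (AlgPoints.map g₀ P).pt
    rw [hg₀pt P]
  have hrange : Set.range g₀.left.base ⊆ Set.range e.left.base :=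
    range_subset_of_isLocallyClosed_of_forall_pt_mem (T := X₂) g₀.left e.left.isLocallyClosed_range hpts
  obtain ⟨ψ, hψe⟩ := exists_hom_comp_eq_of_range_subset_of_isImmersion (T := X₂) e g₀ hrange
  refine ⟨ψ, fun P => ?_⟩
  -- points agree because `e` is injective on complex points
  apply AlgPoints.eq_of_pt_eq
  apply he_inj
  have h1 : AlgPoints.map e (AlgPoints.map ψ P) = AlgPoints.map e (f₂ P) := by
    rw [← AlgPoints.map_comp_apply, hψe, hg₀pt P]
  have h2 := congrArg AlgPoints.pt h1
  simpa only [AlgPoints.pt_map] using h2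

end UnitaryBallUniformisationDatum

end Literature.AlgebraicGeometry.ShimuraVarieties

end
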